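import Summits.HodgeConjecture.HodgeConjecture.Theses.NoetherLefschetzOneUp
import Summits.HodgeConjecture.HodgeConjecture.Theorems.NoetherLefschetzOneUpK3TypeNetsStubNetStructure
import Summits.HodgeConjecture.HodgeConjecture.Theorems.NoetherLefschetzOneUpK3TypeNetsStubFibreClassMultiple
import Summits.HodgeConjecture.HodgeConjecture.Theorems.NoetherLefschetzOneUpK3TypeNetsStubFibreClassTransport
import Literature.AlgebraicGeometry.HodgeTheory.HodgeTypeConjugation
import Literature.AlgebraicGeometry.HodgeTheory.AlgebraicClassesHodgeTypeHolds
import Literature.AlgebraicGeometry.Motives.FiberNetExistence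

/-!
# Crux `K3TypeNets` (stmt-HodgeConjecture-11600) — line `birth`/`registered`, skeleton v3 (lead reshape + Picard dichotomy)

Route `HodgeConjecture/NoetherLefschetzOneUp`, crux #2 `K3TypeNets` (K3-TYPE NETS): for every smooth
projective fourfold `X` and surjective `f : X ⟶ ℙ²_ℂ` whose fibres over the `ℂ`-points off a proper
Zariski-closed `T ⊊ ℙ²` are smooth projective surfaces of geometric genus `h^{2,0} = 1`, the span of the
rational `(2,2)`-classes of `X` lies in `algebraicClasses X 2 ⊔ V_f`, `V_f` the span of the rational
`(2,2)`-classes dying on `X ∖ f⁻¹C` for some Zariski-closed `C ⊊ ℙ²` (VERTICAL classes).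

Birth skeleton by `planner-skel-stmt-HodgeConjecture-11600-0` (2026-08-17, `Lines/birth.lean`, four
stubs); RESHAPED by the lead `prover-line-stmt-HodgeConjecture-11600-c1-0` (v2, 2026-08-17: five NAMED
stubs on a smooth open `U`; S1, S2a, S2b LANDED in wave 1 — p147213, p147562, p147513 — and are wired in
below by name); v3 (same day, cycle-1 boundary) ADOPTS the strategist's Picard dichotomy
(`Lines/picard_dichotomy.lean` by `planner-cstrat-stmt-HodgeConjecture-11600-s2-0`, STRATEGY-CENSUS.md):
the open stubs S3/S4 (regular / irregular) are replaced by S3c `stub_isogenySector` (Picard number constant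
on `U(ℂ)`: the ISOGENY sector, regular or not — it contains the bi-double-cover nets `(S × B)/(ι × τ) → ℙ²`
with Hodge classes `Hom_Hdg(T(S), T(B))`, which the old S3 contained silently), S3j
`stub_nlSupportRegularJumping` and S4j `stub_nlSupportIrregularJumping` (old S3 / S4 plus a Picard jump in
`U(ℂ)`: the NOETHER–LEFSCHETZ sector, where Green's density gives the NL supply the route thesis assumes).
`sorry` lives ONLY inside S3c, S3j, S4j; the kernel-checked composition `K3TypeNets_of` (§3) concludes the
route decl `Summit.HodgeConjecture.HodgeConjecture.Theses.NoetherLefschetzOneUp.K3TypeNets` BY NAME.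
All three open stubs are HC-implied and NOT theorems in print (S3c: Hodge similarities / real
multiplication between K3-type lattices, Varesco 2023; S3j: the route thesis; S4j: contains the RM
`E_s × E_t` nets of the refuter's SCOPE.md).

## What changed in v2 and why (lead reshape, same composition idea)

* The birth stub `stub_fibreClassCalibration` (S2) quantified the fibre-triviality of the calibrated
  class over ALL `ℂ`-points off the hypothesis' closed set `T`. Its proof needs Ehresmann (local
  constancy of restrictions to fibres), which the tree supplies over the SMOOTH BASE of the fibration
  (`FiberNet.smoothBase`, `isCohomologicallyLocallyTrivialOn_univ_of_smooth`,
  `FibreRestrictionsLocallyConstantRank`), not over `ℙ² ∖ T` (a smooth fibre over a closed point of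
  `T ∖ Δ`… is fine, but "smooth closed fibre ⇒ `f` smooth along it" is miracle flatness, absent from the
  tree). v2 therefore moves the whole line onto a SMOOTH OPEN `U ⊆ ℙ²` (`Smooth (f.left ∣_ U)`): the
  composition takes `U := (ℙ² ∖ T) ∩ (smooth base of the tautological surface net)`, non-empty because
  `ℙ²` is irreducible and the smooth base is non-empty in characteristic `0` (generic smoothness,
  `FiberNet.smoothBase_nonempty_of_charZero`), smooth over `U` by maximality of the smooth locus.
* S2 is split in two M/L-sized registered stubs: `stub_fibreClassMultiple` (S2a, fibrewise: ONE global
  rational algebraic `σ` — `h ∪ h` — such that on every smooth fibre every rational class is a RATIONAL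
  multiple of `σ|_{X_s}`; hard Lefschetz for the pulled-back hyperplane class of the surface `X_s`,
  `hasHardLefschetzProperty_map_of_forall_eq_smul`, and `H⁰(X_s(ℂ)) = ℂ`) and `stub_fibreClassTransport`
  (S2b, Ehresmann: vanishing of the restriction of a global class to the fibres is constant along the
  `ℂ`-points of a smooth open `U`, `U(ℂ)` being connected).
* S3/S4 (`stub_nlSupportRegular` / `stub_nlSupportIrregular`) keep their conclusion VERBATIM and their
  mathematical content, but receive the net data in the smooth-open form every proof will want: an open
  `U ≠ ⊥` with `Smooth (f.left ∣_ U)`, fibres over the `ℂ`-points of `U` smooth projective with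
  `h^{2,0} = 1`, regular (S3) resp. some irregular (S4), and a rational `(2,2)`-class trivial on every
  fibre over `U`.
* S1 (`stub_netStructure`) is unchanged.

## The cut: along the Leray edge of `f`, then by the irregularity of the fibres

Write `U ⊆ ℙ² ∖ T` for a non-empty open over which `f` is smooth. The route's reading of the crux
(Arapura 2022, Cor. 1.4 / Rmk. 1.6) locates the one undischarged piece of `H⁴(X)` in `H²(U, R²f_*ℚ)`
(and, for irregular fibres, `H¹(U, R³f_*ℚ)`), i.e. INSIDE the first step
`L¹H⁴ = ker (H⁴(X) → H⁰(U, R⁴f_*ℚ) = H⁴(X_s))` of the Leray filtration, and claims that there the Hodge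
classes are spanned by the NL-GYSIN classes `G_{C,v}` (supported on the threefold `f⁻¹(C)` over a
Noether–Lefschetz curve `C`: vertical) and by MULTISECTIONS (algebraic).

* `stub_netStructure` (S1, size M; theorem) — `f` has geometrically connected fibres (Zariski / Stein
  over the normal base `ℙ²`; in tree: `LevelZeroNetsStein.geometricallyConnected_of_isPreconnected_fibres`)
  and is smooth of relative dimension two wherever it is smooth (in tree:
  `Motives.smoothOfRelativeDimension_morphismRestrict_of_isSmoothProjective`). These are the two fields
  of `Motives.SurfaceNet.ofFibration`.
* `stub_fibreClassMultiple` (S2a, size M/L; theorem) — ONE rational algebraic `σ ∈ H⁴(X)` (`h ∪ h`,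
  `h = ι^* r₀` for a projective embedding `ι` and a rational generator `r₀` of `H²(ℙᴺ(ℂ); ℂ)`) such that
  on every smooth projective fibre `X_s` every rational `c` restricts to a RATIONAL multiple of
  `σ|_{X_s}` (`σ|_{X_s} = L_s² 1 ≠ 0` spans the line `H⁴(X_s(ℂ); ℂ)` by hard Lefschetz for the surface;
  rationality of `c|_{X_s}` and `σ|_{X_s}` forces `q ∈ ℚ`).
* `stub_fibreClassTransport` (S2b, size M/L; theorem) — over a smooth open `U`, if a global class dies
  on one fibre `X_{s₀}`, `s₀ ∈ U(ℂ)`, it dies on every fibre over `U(ℂ)` (flat sections of `R⁴f_*ℂ|_U`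
  over the connected `U(ℂ)`: `FibreRestrictionsLocallyConstantRank` + Ehresmann for the smooth family
  of the net + `ComplexPoints.isConnected_setOf_pt_mem_inter_of_isIrreducible`).
* `stub_isogenySector` (S3c, XL/open), `stub_nlSupportRegularJumping` (S3j, XL — the heart of the
  mechanism, open), `stub_nlSupportIrregularJumping` (S4j, XL/open — the refuter's regime): every
  fibre-trivial rational `(2,2)`-class over `U` is `a + (c - a)` with `a` rational algebraic and `c - a`
  supported over a proper closed `C ⊊ ℙ²`, in the Picard-constant sector (S3c) and in the Picard-jumping
  sector split by regularity (S3j / S4j). HC-implied (`a := c`, `C := ∅`).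

Composition `K3TypeNets_of` (§3, no `sorry`): S1; the tautological net `N` and `U := Tᶜ ⊓ N.smoothBase`
(`U ≠ ⊥`, `Smooth (f ∣_ U)`); `span_le`; S2a gives `σ` and, at some `s₀ ∈ U(ℂ)`, `q ∈ ℚ` with
`(c - q σ)|_{X_{s₀}} = 0`; S2b transports this to all of `U(ℂ)`; the calibrated class is rational and of
type `(2,2)` (`σ` algebraic ⇒ `(2,2)`, `isOfHodgeType_of_mem_algebraicClasses_of_isSmoothProjective`);
`by_cases` Picard-constancy on `U(ℂ)` → S3c, else `by_cases` regularity → S3j / S4j; the residual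
`c - q σ - a` is a GENERATOR of `V_f`; reassemble.

## References

* [Arapura2022] D. Arapura, *Hodge cycles and the Leray filtration*, Pacific J. Math. 319 (2022)
  233–258 = arXiv:2103.05038, Thm. 1.2, Cor. 1.4, Cor. 1.5, Rmk. 1.6.
* [VoisinHodgeI2002] C. Voisin, *Hodge Theory and Complex Algebraic Geometry I*, Thm. 6.25, §7.1.2,
  §9.2.1, Thm. 9.3. [VoisinHodgeII2003] *II*, §4.3 (Leray), Prop. 9.21.
* [Hartshorne1977] R. Hartshorne, *Algebraic Geometry*, III Cor. 10.7, III Cor. 11.3–11.5.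
* [StacksProject] Tag 0AY8. [Green1989NLComponents] [Garcia2016] [Kollar1986] [DeligneHodgeIII1974]
  [VanGeemen2008RM, §3] [Huybrechts2019, Rem. 3.3] — as in `Lines/birth.md`.
-/

noncomputable section

set_option linter.dupNamespace false

open CategoryTheory AlgebraicGeometry

namespace Summit.HodgeConjecture.HodgeConjecture.Cruxes.K3TypeNets.Birth

open Literature.AlgebraicGeometry.Motives Literature.AlgebraicGeometry.HodgeTheory
open Summit.HodgeConjecture.HodgeConjecture.Theses.NoetherLefschetzOneUp (K3TypeNets)

/-! ## §1 The six registered stubs (S1, S2a, S2b LANDED in wave 1; `sorry` lives ONLY in S3c, S3j, S4j) -/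

/-- **Stub S1 — a K3-type fibration of a fourfold over `ℙ²` is a surface net** (size M; theorem in
print). For `X` smooth projective of dimension `4`, `f : X ⟶ ℙ²_ℂ` surjective on points, with smooth
projective (geometrically irreducible) surface fibres over the `ℂ`-points off a proper closed `T`:
`f` has geometrically connected fibres (Stein factorisation over the normal base `ℙ²`; Zariski's
connectedness theorem — Stacks 0AY8; in tree `LevelZeroNetsStein.geometricallyConnected_of_isPreconnected_fibres`),
and wherever `f` is smooth it is smooth of relative dimension `2` (in tree
`Motives.smoothOfRelativeDimension_morphismRestrict_of_isSmoothProjective`). Exactly the two extra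
fields of `Motives.SurfaceNet.ofFibration`.
[cite: StacksProject, Tag 0AY8] [cite: Hartshorne1977, III Cor. 11.3 and Cor. 11.5, III Prop. 10.4] -/
theorem stub_netStructure :
    ∀ ⦃X : SchemeOver ℂ⦄ (f : X ⟶ projectiveSpace 2 ℂ), IsSmoothProjective 4 X →
      Function.Surjective f.left.base →
      (∃ T : Set (projectiveSpace 2 ℂ).left, IsClosed T ∧ T ≠ Set.univ ∧
        ∀ s : AlgPoints (projectiveSpace 2 ℂ) ℂ, s.pt ∉ T → IsSmoothProjective 2 (fiberOver f s)) →
      GeometricallyConnected f.left ∧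
        ∀ U : (projectiveSpace 2 ℂ).left.Opens,
          Smooth (f.left ∣_ U) → SmoothOfRelativeDimension 2 (f.left ∣_ U) :=
  -- LANDED (wave 1, p147213): `Theorems/NoetherLefschetzOneUpK3TypeNetsStubNetStructure.lean`
  Summit.HodgeConjecture.HodgeConjecture.Theorems.stub_netStructure

/-- **Stub S2a — fibrewise calibration by a multisection class** (size M/L; theorem — the fibrewise
half of the Leray edge `H⁴(X) → H⁴(X_s)`). For `X` smooth projective of dimension `4` and any
`f : X ⟶ ℙ²` there is ONE rational algebraic class `σ ∈ H⁴(X(ℂ); ℂ)` — intended `σ = h ∪ h`,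
`h = ι^* r₀` for a closed immersion `ι : X ⟶ ℙᴺ` (`IsSmoothProjective.isProjectiveOver`) and a rational
generator `r₀` of `H²(ℙᴺ(ℂ); ℂ)` (`exists_isRationalClass_forall_eq_smul_projectiveSpace`); algebraic by
`cupProduct_map_projectiveSpace_mem_algebraicClasses` — such that on EVERY smooth projective fibre
`X_s = fiberOver f s` every rational `c ∈ H⁴(X(ℂ); ℂ)` restricts to a RATIONAL multiple of `σ|_{X_s}`:
`σ|_{X_s} = L_s² 1 ≠ 0` spans the line `H⁴(X_s(ℂ); ℂ)` (hard Lefschetz for the pulled-back class of the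
surface `X_s ↪ X ↪ ℙᴺ`, `hasHardLefschetzProperty_map_of_forall_eq_smul`; `H⁰(X_s(ℂ); ℂ) = ℂ · 1`),
and a rational class which is a complex multiple of a non-zero rational class is a rational multiple
of it. [cite: VoisinHodgeI2002, Thm. 6.25 and §7.1.2] [cite: VoisinHodgeII2003, Prop. 9.21]
[cite: Arapura2022, Cor. 1.4 (the edge `H⁰(U, R⁴f_*ℚ)`)] -/
theorem stub_fibreClassMultiple :
    ∀ ⦃X : SchemeOver ℂ⦄ (f : X ⟶ projectiveSpace 2 ℂ), IsSmoothProjective 4 X →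
      ∃ σ : complexBetti X (2 * 2), IsRationalClass σ ∧ σ ∈ algebraicClasses X 2 ∧
        ∀ s : AlgPoints (projectiveSpace 2 ℂ) ℂ, IsSmoothProjective 2 (fiberOver f s) →
          ∀ c : complexBetti X (2 * 2), IsRationalClass c →
            ∃ q : ℚ, complexBetti.map (fiberι f s) (2 * 2) (c - (q : ℂ) • σ) = 0 :=
  -- LANDED (wave 1, p147562): `Theorems/NoetherLefschetzOneUpK3TypeNetsStubFibreClassMultiple.lean`
  Summit.HodgeConjecture.HodgeConjecture.Theorems.stub_fibreClassMultiple

/-- **Stub S2b — fibre-triviality is transported along a smooth open** (size M/L; theorem —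
Ehresmann). For `X` smooth projective of dimension `4`, `f : X ⟶ ℙ²` with geometrically connected
fibres and of relative dimension two where smooth (S1: so `(X, f)` is the tautological surface net
`SurfaceNet.ofFibration`), an open `U ⊆ ℙ²` with `Smooth (f.left ∣_ U)` (hence `U ≤ smoothBase`,
`FiberNet.le_smoothBase_of_smooth`), and a class `c ∈ H⁴(X(ℂ); ℂ)`: if `c|_{X_{s₀}} = 0` for ONE
`ℂ`-point `s₀` of `U` then `c|_{X_s} = 0` for EVERY `ℂ`-point `s` of `U`. In print: the restrictions
are a flat section of the local system `R⁴f_*ℂ|_U` (Ehresmann, Voisin I Thm. 9.3 / §9.2.1) over the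
connected `U(ℂ)` (SGA1 XII 2.4), and a flat section vanishing at one point vanishes. In tree:
`isCohomologicallyLocallyTrivialOn_univ_of_smooth` for `N.smoothFamily`
(`isSmoothProjectiveFamily_smoothFamily`) descended to `f` over `smoothBase(ℂ)`
(`isCohomologicallyLocallyTrivialOn_range_of_familyPullback`), `.mono` to `U(ℂ)`,
`map_fiberι_ne_zero_of_isPreconnected` / `isOpen_setOf_map_fiberι_eq_zero` of
`FibreRestrictionsLocallyConstantRank`, and `ComplexPoints.isConnected_setOf_pt_mem_inter_of_isIrreducible`.
[cite: VoisinHodgeI2002, §9.2.1 and Thm. 9.3] [cite: SGA1, Exp. XII Prop. 2.4] -/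
theorem stub_fibreClassTransport :
    ∀ ⦃X : SchemeOver ℂ⦄ (f : X ⟶ projectiveSpace 2 ℂ), IsSmoothProjective 4 X →
      GeometricallyConnected f.left →
      (∀ U : (projectiveSpace 2 ℂ).left.Opens,
        Smooth (f.left ∣_ U) → SmoothOfRelativeDimension 2 (f.left ∣_ U)) →
      ∀ U : (projectiveSpace 2 ℂ).left.Opens, Smooth (f.left ∣_ U) →
        ∀ c : complexBetti X (2 * 2), ∀ s₀ s : AlgPoints (projectiveSpace 2 ℂ) ℂ,
          s₀.pt ∈ U → s.pt ∈ U →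
          complexBetti.map (fiberι f s₀) (2 * 2) c = 0 →
          complexBetti.map (fiberι f s) (2 * 2) c = 0 :=
  -- LANDED (wave 1, p147513): `Theorems/NoetherLefschetzOneUpK3TypeNetsStubFibreClassTransport.lean`
  Summit.HodgeConjecture.HodgeConjecture.Theorems.stub_fibreClassTransport

/-- **Stub S3c — the ISOGENY sector: fibre-trivial Hodge classes of a K3-type net with CONSTANT Picard
number** (size XL/open core — NEW in this line). Data: a K3-type net `f : X ⟶ ℙ²` (surjective,
geometrically connected fibres, relative dimension two where smooth), a non-empty open `U ⊆ ℙ²` over which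
`f` is SMOOTH, fibres over `U(ℂ)` smooth projective with `h^{2,0} = 1` (regular OR irregular), and ALL
fibres over `U(ℂ)` with the same Picard number `dim_ℂ span{rational (1,1)-classes}`; conclusion as in the
live S3/S4: every fibre-trivial rational `(2,2)`-class is `a + (c - a)`, `a` rational algebraic, `c - a`
supported over a proper closed `C ⊊ ℙ²`. Reading: no NL point in `U` ⇒ period map constant on `U`
(Green's criterion read backwards) ⇒ the transcendental variation is constant `= T₀` on a finite étale
cover `U' → U` ⇒ the Hodge classes in question are `Hom_Hdg(T₀, gr^W_2 H²(U'))` and must be carried by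
multisections alone (NL supply empty). Contains `Hom_Hdg(T(S), T(B))` for bi-double covers
`(S × B)/(ι × τ) → ℙ²` (S a K3 with non-symplectic involution, B any double plane): Buskin / Huybrechts for
isometries, CM-span; similarities of non-square multiplier and real multiplication OPEN (Varesco 2023).
HC-implied (`a := c`, `C := ∅`). [cite: Buskin2019, Thm. 1.1] [cite: Huybrechts2019, Thm. 0.2 and Rem. 3.3]
[cite: Varesco2023, Introduction and Thm. 1] [cite: VoisinHodgeII2003, Prop. 5.20] -/
theorem stub_isogenySector :
    ∀ ⦃X : SchemeOver ℂ⦄ (f : X ⟶ projectiveSpace 2 ℂ), IsSmoothProjective 4 X →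
      Function.Surjective f.left.base → GeometricallyConnected f.left →
      (∀ U : (projectiveSpace 2 ℂ).left.Opens,
        Smooth (f.left ∣_ U) → SmoothOfRelativeDimension 2 (f.left ∣_ U)) →
      ∀ U : (projectiveSpace 2 ℂ).left.Opens, U ≠ ⊥ → Smooth (f.left ∣_ U) →
        (∀ s : AlgPoints (projectiveSpace 2 ℂ) ℂ, s.pt ∈ U →
          IsSmoothProjective 2 (fiberOver f s) ∧
            ∃ A : HodgeModel 2 (fiberOver f s), Module.finrank ℂ ↥(A.hodgePQ 2 2 0) = 1) →
        (∀ s t : AlgPoints (projectiveSpace 2 ℂ) ℂ, s.pt ∈ U → t.pt ∈ U →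
          Module.finrank ℂ ↥(Submodule.span ℂ {x : complexBetti (fiberOver f s) (2 * 1) |
              IsRationalClass x ∧ IsOfHodgeType 2 (fiberOver f s) (2 * 1) 1 1 x}) =
            Module.finrank ℂ ↥(Submodule.span ℂ {x : complexBetti (fiberOver f t) (2 * 1) |
              IsRationalClass x ∧ IsOfHodgeType 2 (fiberOver f t) (2 * 1) 1 1 x})) →
        ∀ c : complexBetti X (2 * 2), IsRationalClass c → IsOfHodgeType 4 X (2 * 2) 2 2 c →
          (∀ s : AlgPoints (projectiveSpace 2 ℂ) ℂ, s.pt ∈ U →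
            complexBetti.map (fiberι f s) (2 * 2) c = 0) →
          ∃ a : complexBetti X (2 * 2), IsRationalClass a ∧ a ∈ algebraicClasses X 2 ∧
            ∃ C : Set (projectiveSpace 2 ℂ).left, IsClosed C ∧ C ≠ Set.univ ∧
              complexBetti.restrictCompl X (f.left.base ⁻¹' C) (2 * 2) (c - a) = 0 := by
  sorry

/-- **Stub S3j — NL support of fibre-trivial Hodge classes, REGULAR fibres, JUMPING Picard number** (size
XL — the heart of the route's mechanism on its true home). The live S3 (`q = 0` fibres, fibre-trivial
rational `(2,2)`-class over a non-empty smooth open `U`) with ONE extra hypothesis: two fibres over `U(ℂ)`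
have different Picard numbers. A Picard jump in `U` is a Noether–Lefschetz point, so the period map is
non-constant and — `h^{2,0} = 1 < 2 = dim ℙ²` — Noether–Lefschetz CURVES exist and are analytically dense
(Green; Oguiso): the supply of vertical algebraic classes `G_{C,v}` (Lefschetz (1,1) on the threefolds
`f⁻¹C`) is non-empty and dense; the claim is `Hdg ∩ L¹ = span{G_{C,v}} + span{pr[Σ]}` (bi-type
`(1,1)_B ⊗ (1,1)_𝕋` by Kollár's vanishing over `ℙ²`; completeness audited by the pulled-back
García–Kudla–Millson theta series). HC-implied (`a := c`, `C := ∅`); not in print. Calibration families with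
`CH₀` on a threefold (X_(1,4), quadric nets of Q⁴, hyperplane nets of quartic fourfolds) are in print here
(Conte–Murre / Bloch–Srinivas); open members have `K_X` pseudo-effective (special X_(3,4) ⊂ ℙ²×ℙ³).
[cite: Arapura2022, Thm. 1.2, Cor. 1.4 and Rmk. 1.6] [cite: Green1989NLComponents]
[cite: VoisinHodgeII2003, Prop. 5.20 and Prop. 10.26] [cite: Garcia2016, Thm. 1.2] [cite: Kollar1986, Thm. 2.1]
[cite: DeligneHodgeIII1974, Cor. 8.2.8] -/
theorem stub_nlSupportRegularJumping :
    ∀ ⦃X : SchemeOver ℂ⦄ (f : X ⟶ projectiveSpace 2 ℂ), IsSmoothProjective 4 X →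
      Function.Surjective f.left.base → GeometricallyConnected f.left →
      (∀ U : (projectiveSpace 2 ℂ).left.Opens,
        Smooth (f.left ∣_ U) → SmoothOfRelativeDimension 2 (f.left ∣_ U)) →
      ∀ U : (projectiveSpace 2 ℂ).left.Opens, U ≠ ⊥ → Smooth (f.left ∣_ U) →
        (∀ s : AlgPoints (projectiveSpace 2 ℂ) ℂ, s.pt ∈ U →
          IsSmoothProjective 2 (fiberOver f s) ∧
            ∃ A : HodgeModel 2 (fiberOver f s), Module.finrank ℂ ↥(A.hodgePQ 2 2 0) = 1) →
        (∀ s : AlgPoints (projectiveSpace 2 ℂ) ℂ, s.pt ∈ U →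
          ∀ A : HodgeModel 2 (fiberOver f s), Module.finrank ℂ ↥(A.hodgePQ 1 1 0) = 0) →
        (∃ s t : AlgPoints (projectiveSpace 2 ℂ) ℂ, s.pt ∈ U ∧ t.pt ∈ U ∧
          Module.finrank ℂ ↥(Submodule.span ℂ {x : complexBetti (fiberOver f s) (2 * 1) |
              IsRationalClass x ∧ IsOfHodgeType 2 (fiberOver f s) (2 * 1) 1 1 x}) ≠
            Module.finrank ℂ ↥(Submodule.span ℂ {x : complexBetti (fiberOver f t) (2 * 1) |
              IsRationalClass x ∧ IsOfHodgeType 2 (fiberOver f t) (2 * 1) 1 1 x})) →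
        ∀ c : complexBetti X (2 * 2), IsRationalClass c → IsOfHodgeType 4 X (2 * 2) 2 2 c →
          (∀ s : AlgPoints (projectiveSpace 2 ℂ) ℂ, s.pt ∈ U →
            complexBetti.map (fiberι f s) (2 * 2) c = 0) →
          ∃ a : complexBetti X (2 * 2), IsRationalClass a ∧ a ∈ algebraicClasses X 2 ∧
            ∃ C : Set (projectiveSpace 2 ℂ).left, IsClosed C ∧ C ≠ Set.univ ∧
              complexBetti.restrictCompl X (f.left.base ⁻¹' C) (2 * 2) (c - a) = 0 := by
  sorry

/-- **Stub S4j — NL support of fibre-trivial Hodge classes, IRREGULAR fibres, JUMPING Picard number**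
(size XL/open — the refuter's regime with supply present). The live S4 (some fibre over `U(ℂ)` has
`h^{1,0} ≠ 0`) with the extra hypothesis "two fibres over `U(ℂ)` have different Picard numbers" (period
map non-constant, NL curves dense). The `E_s × E_t` nets on squares of real-multiplication elliptic K3s
(the parent's why-might-fail; vanGeemen 2008 §3, Huybrechts 2019 Rem. 3.3) are Picard-JUMPING and live
here, now next to a non-empty NL supply and the Mordell–Weil supply of `H¹(U, R³) ≅ H¹(U, R¹)(-1)`.
HC-implied (`a := c`, `C := ∅`). [cite: Arapura2022, Cor. 1.4] [cite: VanGeemen2008RM, §3]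
[cite: Huybrechts2019, Rem. 3.3] [cite: Zucker1977] [cite: VoisinHodgeII2003, Prop. 5.20] -/
theorem stub_nlSupportIrregularJumping :
    ∀ ⦃X : SchemeOver ℂ⦄ (f : X ⟶ projectiveSpace 2 ℂ), IsSmoothProjective 4 X →
      Function.Surjective f.left.base → GeometricallyConnected f.left →
      (∀ U : (projectiveSpace 2 ℂ).left.Opens,
        Smooth (f.left ∣_ U) → SmoothOfRelativeDimension 2 (f.left ∣_ U)) →
      ∀ U : (projectiveSpace 2 ℂ).left.Opens, U ≠ ⊥ → Smooth (f.left ∣_ U) →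
        (∀ s : AlgPoints (projectiveSpace 2 ℂ) ℂ, s.pt ∈ U →
          IsSmoothProjective 2 (fiberOver f s) ∧
            ∃ A : HodgeModel 2 (fiberOver f s), Module.finrank ℂ ↥(A.hodgePQ 2 2 0) = 1) →
        (∃ s : AlgPoints (projectiveSpace 2 ℂ) ℂ, s.pt ∈ U ∧
          ∃ A : HodgeModel 2 (fiberOver f s), Module.finrank ℂ ↥(A.hodgePQ 1 1 0) ≠ 0) →
        (∃ s t : AlgPoints (projectiveSpace 2 ℂ) ℂ, s.pt ∈ U ∧ t.pt ∈ U ∧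
          Module.finrank ℂ ↥(Submodule.span ℂ {x : complexBetti (fiberOver f s) (2 * 1) |
              IsRationalClass x ∧ IsOfHodgeType 2 (fiberOver f s) (2 * 1) 1 1 x}) ≠
            Module.finrank ℂ ↥(Submodule.span ℂ {x : complexBetti (fiberOver f t) (2 * 1) |
              IsRationalClass x ∧ IsOfHodgeType 2 (fiberOver f t) (2 * 1) 1 1 x})) →
        ∀ c : complexBetti X (2 * 2), IsRationalClass c → IsOfHodgeType 4 X (2 * 2) 2 2 c →
          (∀ s : AlgPoints (projectiveSpace 2 ℂ) ℂ, s.pt ∈ U →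
            complexBetti.map (fiberι f s) (2 * 2) c = 0) →
          ∃ a : complexBetti X (2 * 2), IsRationalClass a ∧ a ∈ algebraicClasses X 2 ∧
            ∃ C : Set (projectiveSpace 2 ℂ).left, IsClosed C ∧ C ≠ Set.univ ∧
              complexBetti.restrictCompl X (f.left.base ⁻¹' C) (2 * 2) (c - a) = 0 := by
  sorry

/-! ## §2 Name-keyed statements of the stubs

The skeleton audit matches a hypothesis of `K3TypeNets_of` to a registered stub by the last name
component of its head symbol; each `Registered.stub_*` is VERBATIM the statement of `stub_*` (§4 checks
this by definitional unfolding). -/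

namespace Registered

/-- Statement of `stub_netStructure` (S1), verbatim. -/
abbrev stub_netStructure : Prop :=
  ∀ ⦃X : SchemeOver ℂ⦄ (f : X ⟶ projectiveSpace 2 ℂ), IsSmoothProjective 4 X →
    Function.Surjective f.left.base →
    (∃ T : Set (projectiveSpace 2 ℂ).left, IsClosed T ∧ T ≠ Set.univ ∧
      ∀ s : AlgPoints (projectiveSpace 2 ℂ) ℂ, s.pt ∉ T → IsSmoothProjective 2 (fiberOver f s)) →
    GeometricallyConnected f.left ∧
      ∀ U : (projectiveSpace 2 ℂ).left.Opens,
        Smooth (f.left ∣_ U) → SmoothOfRelativeDimension 2 (f.left ∣_ U)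

/-- Statement of `stub_fibreClassMultiple` (S2a), verbatim. -/
abbrev stub_fibreClassMultiple : Prop :=
  ∀ ⦃X : SchemeOver ℂ⦄ (f : X ⟶ projectiveSpace 2 ℂ), IsSmoothProjective 4 X →
    ∃ σ : complexBetti X (2 * 2), IsRationalClass σ ∧ σ ∈ algebraicClasses X 2 ∧
      ∀ s : AlgPoints (projectiveSpace 2 ℂ) ℂ, IsSmoothProjective 2 (fiberOver f s) →
        ∀ c : complexBetti X (2 * 2), IsRationalClass c →
          ∃ q : ℚ, complexBetti.map (fiberι f s) (2 * 2) (c - (q : ℂ) • σ) = 0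

/-- Statement of `stub_fibreClassTransport` (S2b), verbatim. -/
abbrev stub_fibreClassTransport : Prop :=
  ∀ ⦃X : SchemeOver ℂ⦄ (f : X ⟶ projectiveSpace 2 ℂ), IsSmoothProjective 4 X →
    GeometricallyConnected f.left →
    (∀ U : (projectiveSpace 2 ℂ).left.Opens,
      Smooth (f.left ∣_ U) → SmoothOfRelativeDimension 2 (f.left ∣_ U)) →
    ∀ U : (projectiveSpace 2 ℂ).left.Opens, Smooth (f.left ∣_ U) →
      ∀ c : complexBetti X (2 * 2), ∀ s₀ s : AlgPoints (projectiveSpace 2 ℂ) ℂ,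
        s₀.pt ∈ U → s.pt ∈ U →
        complexBetti.map (fiberι f s₀) (2 * 2) c = 0 →
        complexBetti.map (fiberι f s) (2 * 2) c = 0

/-- Statement of `stub_isogenySector` (S3c), verbatim. -/
abbrev stub_isogenySector : Prop :=
  ∀ ⦃X : SchemeOver ℂ⦄ (f : X ⟶ projectiveSpace 2 ℂ), IsSmoothProjective 4 X →
    Function.Surjective f.left.base → GeometricallyConnected f.left →
    (∀ U : (projectiveSpace 2 ℂ).left.Opens,
      Smooth (f.left ∣_ U) → SmoothOfRelativeDimension 2 (f.left ∣_ U)) →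
    ∀ U : (projectiveSpace 2 ℂ).left.Opens, U ≠ ⊥ → Smooth (f.left ∣_ U) →
      (∀ s : AlgPoints (projectiveSpace 2 ℂ) ℂ, s.pt ∈ U →
        IsSmoothProjective 2 (fiberOver f s) ∧
          ∃ A : HodgeModel 2 (fiberOver f s), Module.finrank ℂ ↥(A.hodgePQ 2 2 0) = 1) →
      (∀ s t : AlgPoints (projectiveSpace 2 ℂ) ℂ, s.pt ∈ U → t.pt ∈ U →
        Module.finrank ℂ ↥(Submodule.span ℂ {x : complexBetti (fiberOver f s) (2 * 1) |
            IsRationalClass x ∧ IsOfHodgeType 2 (fiberOver f s) (2 * 1) 1 1 x}) =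
          Module.finrank ℂ ↥(Submodule.span ℂ {x : complexBetti (fiberOver f t) (2 * 1) |
            IsRationalClass x ∧ IsOfHodgeType 2 (fiberOver f t) (2 * 1) 1 1 x})) →
      ∀ c : complexBetti X (2 * 2), IsRationalClass c → IsOfHodgeType 4 X (2 * 2) 2 2 c →
        (∀ s : AlgPoints (projectiveSpace 2 ℂ) ℂ, s.pt ∈ U →
          complexBetti.map (fiberι f s) (2 * 2) c = 0) →
        ∃ a : complexBetti X (2 * 2), IsRationalClass a ∧ a ∈ algebraicClasses X 2 ∧
          ∃ C : Set (projectiveSpace 2 ℂ).left, IsClosed C ∧ C ≠ Set.univ ∧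
            complexBetti.restrictCompl X (f.left.base ⁻¹' C) (2 * 2) (c - a) = 0

/-- Statement of `stub_nlSupportRegularJumping` (S3j), verbatim. -/
abbrev stub_nlSupportRegularJumping : Prop :=
  ∀ ⦃X : SchemeOver ℂ⦄ (f : X ⟶ projectiveSpace 2 ℂ), IsSmoothProjective 4 X →
    Function.Surjective f.left.base → GeometricallyConnected f.left →
    (∀ U : (projectiveSpace 2 ℂ).left.Opens,
      Smooth (f.left ∣_ U) → SmoothOfRelativeDimension 2 (f.left ∣_ U)) →
    ∀ U : (projectiveSpace 2 ℂ).left.Opens, U ≠ ⊥ → Smooth (f.left ∣_ U) →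
      (∀ s : AlgPoints (projectiveSpace 2 ℂ) ℂ, s.pt ∈ U →
        IsSmoothProjective 2 (fiberOver f s) ∧
          ∃ A : HodgeModel 2 (fiberOver f s), Module.finrank ℂ ↥(A.hodgePQ 2 2 0) = 1) →
      (∀ s : AlgPoints (projectiveSpace 2 ℂ) ℂ, s.pt ∈ U →
        ∀ A : HodgeModel 2 (fiberOver f s), Module.finrank ℂ ↥(A.hodgePQ 1 1 0) = 0) →
      (∃ s t : AlgPoints (projectiveSpace 2 ℂ) ℂ, s.pt ∈ U ∧ t.pt ∈ U ∧
        Module.finrank ℂ ↥(Submodule.span ℂ {x : complexBetti (fiberOver f s) (2 * 1) |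
            IsRationalClass x ∧ IsOfHodgeType 2 (fiberOver f s) (2 * 1) 1 1 x}) ≠
          Module.finrank ℂ ↥(Submodule.span ℂ {x : complexBetti (fiberOver f t) (2 * 1) |
            IsRationalClass x ∧ IsOfHodgeType 2 (fiberOver f t) (2 * 1) 1 1 x})) →
      ∀ c : complexBetti X (2 * 2), IsRationalClass c → IsOfHodgeType 4 X (2 * 2) 2 2 c →
        (∀ s : AlgPoints (projectiveSpace 2 ℂ) ℂ, s.pt ∈ U →
          complexBetti.map (fiberι f s) (2 * 2) c = 0) →
        ∃ a : complexBetti X (2 * 2), IsRationalClass a ∧ a ∈ algebraicClasses X 2 ∧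
          ∃ C : Set (projectiveSpace 2 ℂ).left, IsClosed C ∧ C ≠ Set.univ ∧
            complexBetti.restrictCompl X (f.left.base ⁻¹' C) (2 * 2) (c - a) = 0

/-- Statement of `stub_nlSupportIrregularJumping` (S4j), verbatim. -/
abbrev stub_nlSupportIrregularJumping : Prop :=
  ∀ ⦃X : SchemeOver ℂ⦄ (f : X ⟶ projectiveSpace 2 ℂ), IsSmoothProjective 4 X →
    Function.Surjective f.left.base → GeometricallyConnected f.left →
    (∀ U : (projectiveSpace 2 ℂ).left.Opens,
      Smooth (f.left ∣_ U) → SmoothOfRelativeDimension 2 (f.left ∣_ U)) →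
    ∀ U : (projectiveSpace 2 ℂ).left.Opens, U ≠ ⊥ → Smooth (f.left ∣_ U) →
      (∀ s : AlgPoints (projectiveSpace 2 ℂ) ℂ, s.pt ∈ U →
        IsSmoothProjective 2 (fiberOver f s) ∧
          ∃ A : HodgeModel 2 (fiberOver f s), Module.finrank ℂ ↥(A.hodgePQ 2 2 0) = 1) →
      (∃ s : AlgPoints (projectiveSpace 2 ℂ) ℂ, s.pt ∈ U ∧
        ∃ A : HodgeModel 2 (fiberOver f s), Module.finrank ℂ ↥(A.hodgePQ 1 1 0) ≠ 0) →
      (∃ s t : AlgPoints (projectiveSpace 2 ℂ) ℂ, s.pt ∈ U ∧ t.pt ∈ U ∧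
        Module.finrank ℂ ↥(Submodule.span ℂ {x : complexBetti (fiberOver f s) (2 * 1) |
            IsRationalClass x ∧ IsOfHodgeType 2 (fiberOver f s) (2 * 1) 1 1 x}) ≠
          Module.finrank ℂ ↥(Submodule.span ℂ {x : complexBetti (fiberOver f t) (2 * 1) |
            IsRationalClass x ∧ IsOfHodgeType 2 (fiberOver f t) (2 * 1) 1 1 x})) →
      ∀ c : complexBetti X (2 * 2), IsRationalClass c → IsOfHodgeType 4 X (2 * 2) 2 2 c →
        (∀ s : AlgPoints (projectiveSpace 2 ℂ) ℂ, s.pt ∈ U →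
          complexBetti.map (fiberι f s) (2 * 2) c = 0) →
        ∃ a : complexBetti X (2 * 2), IsRationalClass a ∧ a ∈ algebraicClasses X 2 ∧
          ∃ C : Set (projectiveSpace 2 ℂ).left, IsClosed C ∧ C ≠ Set.univ ∧
            complexBetti.restrictCompl X (f.left.base ⁻¹' C) (2 * 2) (c - a) = 0

end Registered

/-! ## §3 Glue and composition (no `sorry` from here on) -/

/-- Rational classes are stable under differences (from `IsRationalClass.add/.smul`; the tree's
`IsRationalClass.sub'` lives in a heavier file). [cite: HatcherAT2002, §3.1] -/
theorem isRationalClass_sub {Y : Type} [TopologicalSpace Y] {k : ℕ}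
    {c c' : Literature.AlgebraicTopology.SingularHomology.singularCohomology ℂ ℂ Y k}
    (hc : IsRationalClass c) (hc' : IsRationalClass c') : IsRationalClass (c - c') := by
  have h := hc.add (hc'.smul (-1))
  rwa [Rat.cast_neg, Rat.cast_one, neg_one_smul, ← sub_eq_add_neg] at h

/-- **Two non-empty opens of `ℙ²_ℂ` meet** (`ℙ²` is irreducible: smooth projective varieties are
geometrically irreducible, `IsSmoothProjective.isIntegral_holds`). [folklore] -/
theorem inf_ne_bot_of_projectiveSpace {V W : (projectiveSpace 2 ℂ).left.Opens}
    (hV : (V : Set (projectiveSpace 2 ℂ).left).Nonempty)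
    (hW : (W : Set (projectiveSpace 2 ℂ).left).Nonempty) : V ⊓ W ≠ ⊥ := by
  haveI : IsIntegral (projectiveSpace 2 ℂ).left :=
    IsSmoothProjective.isIntegral_holds (isSmoothProjective_projectiveSpace_holds ℂ 2)
  rw [ne_eq, ← TopologicalSpace.Opens.coe_eq_empty, TopologicalSpace.Opens.coe_inf, ← ne_eq,
    ← Set.nonempty_iff_ne_empty]
  exact nonempty_preirreducible_inter V.isOpen W.isOpen hV hW

/-- **The crux `K3TypeNets` from the three OPEN stubs** (implication form; kernel-checked, no `sorry`;
hypotheses keyed to the registered open stubs S3c / S3j / S4j; the landed S1 / S2a / S2b are used by name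
inside the proof). Proof: net structure (S1); the tautological surface net
`N := SurfaceNet.ofFibration` and the smooth open `U := Tᶜ ⊓ N.smoothBase` — non-empty (`ℙ²`
irreducible, `T ≠ ℙ²`, smooth base non-empty in characteristic `0` by generic smoothness) and with
`f` smooth over it (maximality of the smooth locus); `span_le`; calibrate the fibre class by a rational
multiple of the multisection class `σ` at one `s₀ ∈ U(ℂ)` (S2a) and transport the fibre-triviality of
the calibrated class `c' = c - q σ` to all of `U(ℂ)` (S2b) — `c'` is rational and, `σ` being algebraic
hence `(2,2)` (`isOfHodgeType_of_mem_algebraicClasses_of_isSmoothProjective`), of type `(2,2)`; split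
on the CONSTANCY OF THE PICARD NUMBER over `U(ℂ)` (constant ⇒ S3c, the isogeny sector) and then on the
irregularity of the fibres (S3j / S4j, the Noether–Lefschetz sector) and get `c' = a + (c' - a)`; the
residual is a GENERATOR of the vertical span `V_f`; reassemble `c = (q σ + a) + (c' - a) ∈ algebraicClasses X 2 ⊔ V_f`. -/
theorem K3TypeNets_of (h₃ : Registered.stub_isogenySector)
    (h₄ : Registered.stub_nlSupportRegularJumping) (h₅ : Registered.stub_nlSupportIrregularJumping) :
    K3TypeNets := by
  -- the three LANDED stubs (S1, S2a, S2b) are discharged inside the proof, by name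
  have h₁ : Registered.stub_netStructure := stub_netStructure
  have h₂ : Registered.stub_fibreClassMultiple := stub_fibreClassMultiple
  have h₂' : Registered.stub_fibreClassTransport := stub_fibreClassTransport
  intro X f hX hf hT
  obtain ⟨T, hTc, hTu, hfib⟩ := hT
  -- S1: the fibration is a surface net (connected fibres, relative dimension two where smooth)
  obtain ⟨hconn, hrel⟩ := h₁ f hX hf ⟨T, hTc, hTu, fun s hs ↦ (hfib s hs).1⟩
  haveI := hconn
  -- the tautological surface net and the smooth open `U := Tᶜ ⊓ smoothBase`
  let N : SurfaceNet 2 X := SurfaceNet.ofFibration (m := 2) hX f hrel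
  let U : (projectiveSpace 2 ℂ).left.Opens := ⟨Tᶜ, hTc.isOpen_compl⟩ ⊓ N.smoothBase
  have hUT : ∀ s : AlgPoints (projectiveSpace 2 ℂ) ℂ, s.pt ∈ U → s.pt ∉ T :=
    fun s hs ↦ (TopologicalSpace.Opens.mem_inf.mp hs).1
  have hUne : U ≠ ⊥ :=
    inf_ne_bot_of_projectiveSpace (Set.nonempty_compl.mpr hTu) N.smoothBase_nonempty_of_charZero
  haveI : LocallyOfFinitePresentation f.left := N.locallyOfFinitePresentation_proj
  have hUs : Smooth (f.left ∣_ U) :=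
    Literature.AlgebraicGeometry.Morphisms.smooth_morphismRestrict_of_preimage_le_smoothLocus
      f.left U fun x hx ↦ N.preimage_smoothBase_le_smoothLocus
        (show x ∈ N.proj.left ⁻¹ᵁ N.smoothBase from (TopologicalSpace.Opens.mem_inf.mp hx).2)
  have hfibU : ∀ s : AlgPoints (projectiveSpace 2 ℂ) ℂ, s.pt ∈ U →
      IsSmoothProjective 2 (fiberOver f s) ∧
        ∃ A : HodgeModel 2 (fiberOver f s), Module.finrank ℂ ↥(A.hodgePQ 2 2 0) = 1 :=
    fun s hs ↦ hfib s (hUT s hs)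
  refine Submodule.span_le.mpr ?_
  rintro c ⟨hcQ, hcH⟩
  -- S2a: the multisection class `σ` and the fibrewise rational multiple
  obtain ⟨σ, hσQ, hσA, hmult⟩ := h₂ f hX
  have hσH : IsOfHodgeType 4 X (2 * 2) 2 2 σ :=
    isOfHodgeType_of_mem_algebraicClasses_of_isSmoothProjective hX 2 hσA
  -- S2a at one point of `U(ℂ)`, transported over `U(ℂ)` by S2b
  obtain ⟨q, hq⟩ : ∃ q : ℚ, ∀ s : AlgPoints (projectiveSpace 2 ℂ) ℂ, s.pt ∈ U →
      complexBetti.map (fiberι f s) (2 * 2) (c - (q : ℂ) • σ) = 0 := by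
    by_cases hne : ∃ s₀ : AlgPoints (projectiveSpace 2 ℂ) ℂ, s₀.pt ∈ U
    · obtain ⟨s₀, hs₀⟩ := hne
      obtain ⟨q, hq₀⟩ := hmult s₀ (hfibU s₀ hs₀).1 c hcQ
      exact ⟨q, fun s hs ↦ h₂' f hX hconn hrel U hUs _ s₀ s hs₀ hs hq₀⟩
    · push Not at hne
      exact ⟨0, fun s hs ↦ (hne s hs).elim⟩
  have hc'Q : IsRationalClass (c - (q : ℂ) • σ) := isRationalClass_sub hcQ (hσQ.smul q)
  have hc'H : IsOfHodgeType 4 X (2 * 2) 2 2 (c - (q : ℂ) • σ) := hcH.sub hX (hσH.smul _)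
  -- S3c / S3j / S4j: a fibre-trivial Hodge class is a multisection combination plus a class supported
  -- over a curve — by the Picard dichotomy, then by regularity
  have key : ∃ a : complexBetti X (2 * 2), IsRationalClass a ∧ a ∈ algebraicClasses X 2 ∧
      ∃ C : Set (projectiveSpace 2 ℂ).left, IsClosed C ∧ C ≠ Set.univ ∧
        complexBetti.restrictCompl X (f.left.base ⁻¹' C) (2 * 2) (c - (q : ℂ) • σ - a) = 0 := by
    by_cases hconst : ∀ s t : AlgPoints (projectiveSpace 2 ℂ) ℂ, s.pt ∈ U → t.pt ∈ U →
        Module.finrank ℂ ↥(Submodule.span ℂ {x : complexBetti (fiberOver f s) (2 * 1) |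
            IsRationalClass x ∧ IsOfHodgeType 2 (fiberOver f s) (2 * 1) 1 1 x}) =
          Module.finrank ℂ ↥(Submodule.span ℂ {x : complexBetti (fiberOver f t) (2 * 1) |
            IsRationalClass x ∧ IsOfHodgeType 2 (fiberOver f t) (2 * 1) 1 1 x})
    · -- the isogeny sector
      exact h₃ f hX hf hconn hrel U hUne hUs hfibU hconst _ hc'Q hc'H hq
    · -- the Noether–Lefschetz sector
      push Not at hconst
      obtain ⟨s₁, t₁, hs₁, ht₁, hne₁⟩ := hconst
      by_cases hreg : ∀ s : AlgPoints (projectiveSpace 2 ℂ) ℂ, s.pt ∈ U →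
          ∀ A : HodgeModel 2 (fiberOver f s), Module.finrank ℂ ↥(A.hodgePQ 1 1 0) = 0
      · exact h₄ f hX hf hconn hrel U hUne hUs hfibU hreg ⟨s₁, t₁, hs₁, ht₁, hne₁⟩ _ hc'Q hc'H hq
      · push Not at hreg
        exact h₅ f hX hf hconn hrel U hUne hUs hfibU hreg ⟨s₁, t₁, hs₁, ht₁, hne₁⟩ _ hc'Q hc'H hq
  obtain ⟨a, haQ, haA, C, hCc, hCu, hCa⟩ := key
  have haH : IsOfHodgeType 4 X (2 * 2) 2 2 a :=
    isOfHodgeType_of_mem_algebraicClasses_of_isSmoothProjective hX 2 haA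
  -- the residual class is VERTICAL: a generator of the route's `V_f`
  have hv : c - (q : ℂ) • σ - a ∈ Submodule.span ℂ {c : complexBetti X (2 * 2) |
      IsRationalClass c ∧ IsOfHodgeType 4 X (2 * 2) 2 2 c ∧
        ∃ T : Set (projectiveSpace 2 ℂ).left, IsClosed T ∧ T ≠ Set.univ ∧
          complexBetti.restrictCompl X (f.left.base ⁻¹' T) (2 * 2) c = 0} :=
    Submodule.subset_span ⟨isRationalClass_sub hc'Q haQ, hc'H.sub hX haH, C, hCc, hCu, hCa⟩
  -- reassemble `c = (q • σ + a) + (c - q • σ - a)` : algebraic ⊔ vertical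
  have hdecomp : c = ((q : ℂ) • σ + a) + (c - (q : ℂ) • σ - a) := by abel
  rw [hdecomp]
  exact Submodule.add_mem _
    (Submodule.mem_sup_left (Submodule.add_mem _ (Submodule.smul_mem _ _ hσA) haA))
    (Submodule.mem_sup_right hv)

/-! ## §4 Wiring check -/

/-- The registered stubs feed the composition VERBATIM (definitional unfolding only; this theorem
inherits the three remaining `sorry`s and is not a proof of the item). -/
theorem k3TypeNets_holds_of_stubs : K3TypeNets :=
  K3TypeNets_of stub_isogenySector stub_nlSupportRegularJumping stub_nlSupportIrregularJumping

end Summit.HodgeConjecture.HodgeConjecture.Cruxes.K3TypeNets.Birth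

end
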